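import Mathlib
import Summits.Parity.GeneralizedHardyLittlewood.Theses.LiouvilleMAD
import Summits.Parity.GeneralizedHardyLittlewood.Theorems.LiouvilleMADFanDecorrelationStubFanFromLaws

/-!
# The REPAIRED parent conjecture `SqrtAffineChowla₂'` implies `FanDecorrelation`

Crux `FanDecorrelation` (`Summit.Parity.GeneralizedHardyLittlewood.Theses.LiouvilleMAD`, stmt-Parity-13318), line lead c5,
2026-08-17.  Companion of `Cruxes/FanDecorrelation/SqrtAffineChowlaTwoFalse.lean`, which shows that the crux strategist's
typed parent conjecture `StrategyCensus.SqrtAffineChowla₂` (census STRENGTHEN S1: joint square-root cancellation for two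
affine forms in two variables over boxes) is FALSE as typed (a degenerate row on which the two forms coincide).  This file

* types the REPAIR `SqrtAffineChowla₂'`: verbatim S1 plus two hypotheses — the box contains no ROW on which the forms are
  proportional as polynomials in `x` (`a₁(b₂y + c₂) ≠ a₂(b₁y + c₁)`) and no COLUMN on which they are proportional as
  polynomials in `y` (`b₁(a₂x + c₂) ≠ b₂(a₁x + c₁)`); given `a₁b₂ ≠ a₂b₁` these exclude at most one row and one column of
  `ℤ²`, and they are exactly the configurations whose trivial bias (`X`, resp. `Y`) exceeds `√(XY)` — a coincidence
  `ψ₁ = tψ₂` along any other line meets the box in `≤ min(X/|p|, Y/|q|) + 1 ≤ √(XY) + 1` points;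
* proves `fanDecorrelation_of_sqrtAffineChowla₂' : SqrtAffineChowla₂' → FanDecorrelation` (kernel-checked, no `sorry`),
  with `ϑ = 5/32` — so the census's claim "S1 implies the crux" survives the repair, and 13318 is CLOSED MODULO ONE clean
  random-model statement (next to the landed two-stub normal form p116609 `BinaryFormsChowla ∧ WideHeightLaw ⟹ crux`).

PROOF.  In the variables `(x, y) = (m', j)` the fan `R_k` (`k ≥ 1`; `k ≤ −1` is the swapped pair by `fanSum_neg`,
`|k| ≥ 2Q` is empty by `fanSum_eq_zero_of_le`) is `Σ_{y ∈ [Q,2Q)} Σ_{x ∈ (M, 2M − ky]} λ(ψ₁)λ(ψ₂)` with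
`ψ₁ = n·x + (nk)·y + c = (x+ky)n + c`, `ψ₂ = n'·x + 0·y + c` (`lag_sum_eq`, `fan_eq_rows`); `a₁b₂ − a₂b₁ = −nn'k ≠ 0`.
The region is a trapezoid, not a box: chop the `Q` rows into blocks of `W = ⌈M^{1/4}⌉` rows (`abs_sum_Ioc_le_of_blocks`);
a block `(u, u+Y]` is the COMMON BOX `(M, b(u+Y)] × (u, u+Y]` (`b(y) = max(M, 2M − ky)`) plus, for each of its `≤ W` rows,
a ONE-ROW BOX `(b(u+Y), b(y)] × {y}` of length `≤ kW` (`block_bound`, `bEnd_sub_le`).  The hypothesis bounds the common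
box by `C√(MW)·N^ε` and each one-row box by `C√(kW)·N^ε` (`block_estimate`; heights `≤ N = 8M² + |c| + 8` with `A = 1`;
the non-degeneracy of rows is `row_nondegenerate`: `nn'ky = c(n − n')` is impossible for `y ≥ Q > |c|`, i.e. for
`M ≥ c²` — the disprover's `proportional_lag_small`; columns and positivity: `x > M ≥ |c|`).  Summing,
`|R_k| ≤ (Q/W + 1)·(C√(MW) + W·C√(kW))·N^ε ≤ 24·C⁺(|c|+16)·M^{7/8+2ε}` (`numeric_bound`: `Q ≤ 2√M`, `k < 2Q`,
`M^{1/4} ≤ W ≤ 2M^{1/4}`, `N^ε ≤ (|c|+16)M^{2ε}`), and `ε = 1/64` gives the exponent `29/32 = 3/4 + 5/32`; `M < c²` is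
absorbed by the trivial bound `Q·M² ≤ (|c|+1)⁶` (`abs_fanSum_le`).

STATUS.  `SqrtAffineChowla₂'` is conjecture-grade (it contains square-root two-point Chowla: `Y`-independent instances),
random-model consistent, and — like the crux — beyond every known method; this file is CALIBRATION (what "the random model
predicts the crux" means, made precise and kernel-checked), not a line.  Imports only Mathlib, the route file and the
landed transfer file `LiouvilleMADFanDecorrelationStubFanFromLaws` (p96381: `abs_fanSum_le`, `fanSum_eq_zero_of_le`,
`fanSum_neg`).
-/

namespace Summit.Parity.GeneralizedHardyLittlewood.Cruxes.FanDecorrelation.SqrtAffineChowlaTwoRepaired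

open Finset ArithmeticFunction
open Summit.Parity.GeneralizedHardyLittlewood.Theses.LiouvilleMAD (FanDecorrelation)
open Summit.Parity.GeneralizedHardyLittlewood.Theorems.FanDecorrelation.FanFromLaws
  (abs_fanSum_le fanSum_eq_zero_of_le fanSum_neg)

noncomputable section

/-- `SqrtAffineChowla₂'` — the census's STRENGTHEN S1 (`StrategyCensus.SqrtAffineChowla₂`) REPAIRED by two
non-degeneracy hypotheses: the box contains no ROW on which the two affine forms are proportional as
polynomials in `x` (`a₁(b₂y + c₂) ≠ a₂(b₁y + c₁)`) and no COLUMN on which they are proportional as polynomials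
in `y` (`b₁(a₂x + c₂) ≠ b₂(a₁x + c₁)`).  Everything else is verbatim: for every `ε > 0` and `A` there is `C`
such that for all `N ≥ 1`, boxes `(x₀, x₀+X] × (y₀, y₀+Y]` with `X, Y ≤ N`, `|x₀|, |y₀| ≤ N^A`, and pairs of
affine forms of height `≤ N^A` with `a₁b₂ ≠ a₂b₁`, positive on the box,
`|Σ_box λ(ψ₁)λ(ψ₂)| ≤ C·√(XY)·N^ε`. -/
def SqrtAffineChowla₂' : Prop :=
  ∀ ε : ℝ, 0 < ε → ∀ A : ℝ, ∃ C : ℝ, ∀ N X Y : ℕ, 1 ≤ N → X ≤ N → Y ≤ N →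
    ∀ x₀ y₀ a₁ b₁ c₁ a₂ b₂ c₂ : ℤ,
      |x₀| ≤ (N : ℝ) ^ A → |y₀| ≤ (N : ℝ) ^ A →
      |a₁| ≤ (N : ℝ) ^ A → |b₁| ≤ (N : ℝ) ^ A → |c₁| ≤ (N : ℝ) ^ A →
      |a₂| ≤ (N : ℝ) ^ A → |b₂| ≤ (N : ℝ) ^ A → |c₂| ≤ (N : ℝ) ^ A →
      a₁ * b₂ ≠ a₂ * b₁ →
      (∀ y ∈ Ioc y₀ (y₀ + Y), a₁ * (b₂ * y + c₂) ≠ a₂ * (b₁ * y + c₁)) →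
      (∀ x ∈ Ioc x₀ (x₀ + X), b₁ * (a₂ * x + c₂) ≠ b₂ * (a₁ * x + c₁)) →
      (∀ x ∈ Ioc x₀ (x₀ + X), ∀ y ∈ Ioc y₀ (y₀ + Y), 0 < a₁ * x + b₁ * y + c₁ ∧ 0 < a₂ * x + b₂ * y + c₂) →
        |∑ x ∈ Ioc x₀ (x₀ + X), ∑ y ∈ Ioc y₀ (y₀ + Y),
            (ArithmeticFunction.liouville (Int.toNat (a₁ * x + b₁ * y + c₁)) : ℝ) *
              (ArithmeticFunction.liouville (Int.toNat (a₂ * x + b₂ * y + c₂)) : ℝ)| ≤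
          C * Real.sqrt ((X : ℝ) * Y) * (N : ℝ) ^ ε

/-! ## §1 The fan in the variables `(x, y) = (m', j)` -/

/-- The summand of the fan in the variables `(x, y) = (m', j)`: the two affine forms are
`ψ₁ = n·x + (n·k)·y + c = (x + ky)n + c` and `ψ₂ = n'·x + 0·y + c`. -/
def F (c : ℤ) (n n' : ℕ) (k : ℤ) (x y : ℤ) : ℝ :=
  (liouville (Int.toNat ((n : ℤ) * x + (n : ℤ) * k * y + c)) : ℝ) *
    (liouville (Int.toNat ((n' : ℤ) * x + 0 * y + c)) : ℝ)

/-- Re-indexing one lag: for `k ≥ 0` the pairs `(m, m') ∈ (M,2M]²` with `m − m' = kj` are parametrised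
by `x = m' ∈ (M, 2M − kj]` (an integer interval, empty when `kj ≥ M`). -/
theorem lag_sum_eq (c : ℤ) (n n' M j : ℕ) {k : ℤ} (hk : 0 ≤ k) :
    ∑ p ∈ (Ioc M (2 * M) ×ˢ Ioc M (2 * M)).filter (fun p : ℕ × ℕ => (p.1 : ℤ) - p.2 = k * (j : ℤ)),
        (liouville (Int.toNat ((p.1 : ℤ) * n + c)) : ℝ) * (liouville (Int.toNat ((p.2 : ℤ) * n' + c)) : ℝ) =
      ∑ x ∈ Ioc (M : ℤ) (2 * M - k * j), F c n n' k x j := by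
  have hkj : 0 ≤ k * (j : ℤ) := mul_nonneg hk (by positivity)
  refine Finset.sum_nbij' (fun p : ℕ × ℕ => (p.2 : ℤ))
    (fun x : ℤ => (Int.toNat (x + k * j), Int.toNat x)) ?_ ?_ ?_ ?_ ?_
  · intro p hp
    rw [mem_filter, mem_product, mem_Ioc, mem_Ioc] at hp
    rw [mem_Ioc]
    obtain ⟨⟨⟨h1, h2⟩, ⟨h3, h4⟩⟩, heq⟩ := hp
    constructor
    · exact_mod_cast h3
    · have h2' : (p.1 : ℤ) ≤ 2 * (M : ℤ) := by exact_mod_cast h2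
      linarith
  · intro x hx
    rw [mem_Ioc] at hx
    rw [mem_filter, mem_product, mem_Ioc, mem_Ioc]
    obtain ⟨h1, h2⟩ := hx
    have hx0 : 0 ≤ x := by linarith [(Nat.cast_nonneg M : (0 : ℤ) ≤ M)]
    have hxk0 : 0 ≤ x + k * j := by linarith
    refine ⟨⟨⟨?_, ?_⟩, ⟨?_, ?_⟩⟩, ?_⟩
    · have : (M : ℤ) < x + k * j := by linarith
      have := (Int.lt_toNat.mpr this)
      omega
    · have : x + k * j ≤ ((2 * M : ℕ) : ℤ) := by push_cast; linarith
      exact (Int.toNat_le.mpr this)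
    · have := (Int.lt_toNat.mpr h1)
      omega
    · have : x ≤ ((2 * M : ℕ) : ℤ) := by push_cast; linarith
      exact (Int.toNat_le.mpr this)
    · simp only
      rw [Int.toNat_of_nonneg hxk0, Int.toNat_of_nonneg hx0]
      ring
  · intro p hp
    rw [mem_filter, mem_product, mem_Ioc, mem_Ioc] at hp
    obtain ⟨⟨⟨h1, h2⟩, ⟨h3, h4⟩⟩, heq⟩ := hp
    have hp1 : (p.1 : ℤ) = (p.2 : ℤ) + k * j := by linarith
    ext
    · simp only
      rw [← hp1, Int.toNat_natCast]
    · simp only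
      rw [Int.toNat_natCast]
  · intro x hx
    rw [mem_Ioc] at hx
    have hx0 : 0 ≤ x := by linarith [(Nat.cast_nonneg M : (0 : ℤ) ≤ M), hx.1]
    simp only
    rw [Int.toNat_of_nonneg hx0]
  · intro p hp
    rw [mem_filter, mem_product] at hp
    obtain ⟨_, heq⟩ := hp
    have hp1 : (p.1 : ℤ) = (p.2 : ℤ) + k * j := by linarith
    simp only [F]
    rw [hp1]
    congr 3 <;> ring_nf


/-! ## §2 Integer-interval bookkeeping -/

/-- `Ioc a (max a b) = Ioc a b` (both are empty when `b ≤ a`). -/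
theorem Ioc_max_eq (a b : ℤ) : Ioc a (max a b) = Ioc a b := by
  ext x
  simp only [mem_Ioc, le_max_iff]
  constructor
  · rintro ⟨h1, h2 | h2⟩
    · exact absurd h2 (not_le.mpr h1)
    · exact ⟨h1, h2⟩
  · rintro ⟨h1, h2⟩
    exact ⟨h1, Or.inr h2⟩

/-- Splitting an integer interval sum at an intermediate point. -/
theorem sum_Ioc_split {a b c : ℤ} (hab : a ≤ b) (hbc : b ≤ c) (f : ℤ → ℝ) :
    ∑ x ∈ Ioc a c, f x = ∑ x ∈ Ioc a b, f x + ∑ x ∈ Ioc b c, f x := by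
  rw [← Finset.Ioc_union_Ioc_eq_Ioc hab hbc, sum_union]
  rw [Finset.disjoint_left]
  intro x hx hx'
  rw [mem_Ioc] at hx hx'
  linarith [hx.2, hx'.1]

/-- The one-row box: `Ioc (y − 1) (y − 1 + 1) = {y}`. -/
theorem Ioc_pred_eq_singleton (y : ℤ) : Ioc (y - 1) (y - 1 + ((1 : ℕ) : ℤ)) = {y} := by
  ext z
  simp only [Nat.cast_one, sub_add_cancel, mem_Ioc, mem_singleton]
  omega

/-- CHOPPING an interval of length `L` into blocks of length `≤ W`: if every sub-block sum is bounded by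
`Bnd`, the whole sum is bounded by `(L / W + 1)·Bnd`. -/
theorem abs_sum_Ioc_le_of_blocks (g : ℤ → ℝ) {W : ℕ} (hW : 1 ≤ W) (Bnd : ℝ) :
    ∀ L : ℕ, ∀ a : ℤ,
      (∀ u : ℤ, ∀ Y : ℕ, a ≤ u → u + Y ≤ a + L → Y ≤ W → |∑ y ∈ Ioc u (u + Y), g y| ≤ Bnd) →
        |∑ y ∈ Ioc a (a + L), g y| ≤ ((L / W + 1 : ℕ) : ℝ) * Bnd := by
  intro L
  induction L using Nat.strong_induction_on with
  | _ L ih =>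
    intro a hblk
    have hBnd0 : 0 ≤ Bnd := by
      have h := hblk a 0 le_rfl (by push_cast; linarith [(Nat.cast_nonneg L : (0 : ℤ) ≤ L)]) (by omega)
      simp only [Nat.cast_zero, add_zero, Finset.Ioc_self, sum_empty, abs_zero] at h
      exact h
    by_cases hLW : L ≤ W
    · -- one block
      have h := hblk a L le_rfl le_rfl hLW
      calc |∑ y ∈ Ioc a (a + L), g y| ≤ Bnd := h
        _ = 1 * Bnd := (one_mul _).symm
        _ ≤ ((L / W + 1 : ℕ) : ℝ) * Bnd := by
            refine mul_le_mul_of_nonneg_right ?_ hBnd0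
            have : (1 : ℕ) ≤ L / W + 1 := Nat.le_add_left 1 (L / W)
            exact_mod_cast this
    · -- first block of length W, then induction on the rest
      rw [not_le] at hLW
      have hsplit := sum_Ioc_split (a := a) (b := a + W) (c := a + L)
        (by linarith [(Nat.cast_nonneg W : (0 : ℤ) ≤ W)])
        (by have : ((W : ℕ) : ℤ) ≤ L := by exact_mod_cast hLW.le
            linarith) g
      have h1 : |∑ y ∈ Ioc a (a + W), g y| ≤ Bnd := hblk a W le_rfl (by
        have : ((W : ℕ) : ℤ) ≤ L := by exact_mod_cast hLW.le
        linarith) le_rfl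
      have hrest : |∑ y ∈ Ioc (a + W) (a + W + ((L - W : ℕ) : ℤ)), g y| ≤
          (((L - W) / W + 1 : ℕ) : ℝ) * Bnd := by
        refine ih (L - W) (by omega) (a + W) ?_
        intro u Y hu huY hY
        refine hblk u Y (by linarith [(Nat.cast_nonneg W : (0 : ℤ) ≤ W)]) ?_ hY
        have : (((L - W : ℕ) : ℤ)) = (L : ℤ) - W := by
          rw [Nat.cast_sub hLW.le]
        rw [this] at huY
        linarith
      have hcast : (a + W + ((L - W : ℕ) : ℤ)) = a + L := by
        rw [Nat.cast_sub hLW.le]; ring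
      rw [hcast] at hrest
      have hdiv : (L - W) / W + 1 = L / W := by
        have hW0 : 0 < W := hW
        have : L - W = L - W * 1 := by rw [mul_one]
        rw [this, Nat.sub_mul_div L W 1]
        have : 1 ≤ L / W := (Nat.le_div_iff_mul_le hW0).mpr (by linarith)
        exact Nat.sub_add_cancel this
      rw [hdiv] at hrest
      rw [hsplit]
      calc |∑ y ∈ Ioc a (a + W), g y + ∑ y ∈ Ioc (a + W) (a + L), g y|
          ≤ |∑ y ∈ Ioc a (a + W), g y| + |∑ y ∈ Ioc (a + W) (a + L), g y| := abs_add_le _ _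
        _ ≤ Bnd + ((L / W : ℕ) : ℝ) * Bnd := add_le_add h1 hrest
        _ = ((L / W + 1 : ℕ) : ℝ) * Bnd := by push_cast; ring


/-! ## §3 One block of rows: common box + one short box per row -/

/-- The clamped right end of row `y`: `b y = max M (2M − k y)`. -/
def bEnd (M : ℕ) (k : ℤ) (y : ℤ) : ℤ := max (M : ℤ) (2 * M - k * y)

theorem le_bEnd (M : ℕ) (k : ℤ) (y : ℤ) : (M : ℤ) ≤ bEnd M k y := le_max_left _ _

theorem bEnd_le (M : ℕ) {k : ℤ} (hk : 0 ≤ k) {y : ℤ} (hy : 0 ≤ y) : bEnd M k y ≤ 2 * M := by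
  unfold bEnd
  refine max_le (by linarith [(Nat.cast_nonneg M : (0 : ℤ) ≤ M)]) ?_
  nlinarith

theorem bEnd_antitone (M : ℕ) {k : ℤ} (hk : 0 ≤ k) {y y' : ℤ} (h : y ≤ y') : bEnd M k y' ≤ bEnd M k y := by
  unfold bEnd
  exact max_le_max le_rfl (by nlinarith)

theorem bEnd_sub_le (M : ℕ) {k : ℤ} (hk : 0 ≤ k) {y y' : ℤ} (h : y ≤ y') :
    bEnd M k y - bEnd M k y' ≤ k * (y' - y) := by
  unfold bEnd
  rcases le_total (M : ℤ) (2 * M - k * y) with h1 | h1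
  · rw [max_eq_right h1]
    have : 2 * (M : ℤ) - k * y' ≤ max (M : ℤ) (2 * M - k * y') := le_max_right _ _
    linarith
  · rw [max_eq_left h1]
    have : (M : ℤ) ≤ max (M : ℤ) (2 * M - k * y') := le_max_left _ _
    nlinarith

/-- BLOCK BOUND (abstract): rows `y ∈ (u, u+Y]`, row `y` running over `x ∈ (M, 2M − ky]`; the common box
`(M, b(u+Y)] × (u, u+Y]` is bounded by `B₁` and each leftover row segment `(b(u+Y), b(y)]` by `B₂`. -/
theorem block_bound (G : ℤ → ℤ → ℝ) (M : ℕ) {k : ℤ} (hk : 0 ≤ k) (u : ℤ) (Y : ℕ) {B₁ B₂ : ℝ}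
    (h₁ : |∑ x ∈ Ioc (M : ℤ) (bEnd M k (u + Y)), ∑ y ∈ Ioc u (u + Y), G x y| ≤ B₁)
    (h₂ : ∀ y ∈ Ioc u (u + Y), |∑ x ∈ Ioc (bEnd M k (u + Y)) (bEnd M k y), G x y| ≤ B₂) :
    |∑ y ∈ Ioc u (u + Y), ∑ x ∈ Ioc (M : ℤ) (2 * M - k * y), G x y| ≤ B₁ + Y * B₂ := by
  set bs := bEnd M k (u + Y) with hbs
  have hrow : ∀ y ∈ Ioc u (u + Y), ∑ x ∈ Ioc (M : ℤ) (2 * M - k * y), G x y =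
      ∑ x ∈ Ioc (M : ℤ) bs, G x y + ∑ x ∈ Ioc bs (bEnd M k y), G x y := by
    intro y hy
    rw [mem_Ioc] at hy
    rw [← Ioc_max_eq]
    exact sum_Ioc_split (le_bEnd M k (u + Y)) (bEnd_antitone M hk hy.2) _
  rw [sum_congr rfl hrow, sum_add_distrib, sum_comm]
  have hB₂ : |∑ y ∈ Ioc u (u + Y), ∑ x ∈ Ioc bs (bEnd M k y), G x y| ≤ Y * B₂ := by
    calc |∑ y ∈ Ioc u (u + Y), ∑ x ∈ Ioc bs (bEnd M k y), G x y|
        ≤ ∑ y ∈ Ioc u (u + Y), |∑ x ∈ Ioc bs (bEnd M k y), G x y| := abs_sum_le_sum_abs _ _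
      _ ≤ ∑ _y ∈ Ioc u (u + Y), B₂ := sum_le_sum h₂
      _ = Y * B₂ := by
          rw [sum_const, nsmul_eq_mul, Int.card_Ioc]
          congr 1
          simp
  calc |∑ x ∈ Ioc (M : ℤ) bs, ∑ y ∈ Ioc u (u + Y), G x y +
          ∑ y ∈ Ioc u (u + Y), ∑ x ∈ Ioc bs (bEnd M k y), G x y|
      ≤ |∑ x ∈ Ioc (M : ℤ) bs, ∑ y ∈ Ioc u (u + Y), G x y| +
          |∑ y ∈ Ioc u (u + Y), ∑ x ∈ Ioc bs (bEnd M k y), G x y| := abs_add_le _ _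
    _ ≤ B₁ + Y * B₂ := add_le_add h₁ hB₂

/-! ## §4 Arithmetic side conditions of the crux instance -/

/-- NO DEGENERATE ROW inside the fan: for `y ≥ |c| + 1`, `k ≥ 1`, `1 ≤ n ≠ n'`, the forms
`n x + nk y + c` and `n' x + c` are not proportional on the row `y` (cf. `proportional_lag_small`). -/
theorem row_nondegenerate {c : ℤ} {n n' : ℕ} {k y : ℤ} (hn : 1 ≤ n) (hn' : 1 ≤ n') (hnn' : n ≠ n')
    (hk : 1 ≤ k) (hy : (c.natAbs : ℤ) + 1 ≤ y) :
    (n : ℤ) * (0 * y + c) ≠ (n' : ℤ) * ((n : ℤ) * k * y + c) := by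
  intro heq
  have hn1 : (1 : ℤ) ≤ n := by exact_mod_cast hn
  have hn1' : (1 : ℤ) ≤ n' := by exact_mod_cast hn'
  have hcy : |c| + 1 ≤ y := by rw [← Int.natCast_natAbs]; exact hy
  have hy0 : 0 ≤ y := by linarith [abs_nonneg c]
  -- `n n' k y = c (n − n')`
  have key : (n : ℤ) * n' * k * y = c * ((n : ℤ) - n') := by linarith
  -- lower bound for the left side: `n n' k y ≥ max(n,n') (|c|+1)`
  have hprod : (n : ℤ) * (|c| + 1) ≤ (n : ℤ) * n' * k * y ∧ (n' : ℤ) * (|c| + 1) ≤ (n : ℤ) * n' * k * y := by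
    have h1 : (1 : ℤ) * (|c| + 1) ≤ ((n' : ℤ) * k) * y :=
      mul_le_mul (by nlinarith) hcy (by linarith [abs_nonneg c]) (by nlinarith)
    have h2 : (1 : ℤ) * (|c| + 1) ≤ ((n : ℤ) * k) * y :=
      mul_le_mul (by nlinarith) hcy (by linarith [abs_nonneg c]) (by nlinarith)
    constructor
    · calc (n : ℤ) * (|c| + 1) = (n : ℤ) * (1 * (|c| + 1)) := by ring
        _ ≤ (n : ℤ) * (((n' : ℤ) * k) * y) := mul_le_mul_of_nonneg_left h1 (by linarith)
        _ = (n : ℤ) * n' * k * y := by ring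
    · calc (n' : ℤ) * (|c| + 1) = (n' : ℤ) * (1 * (|c| + 1)) := by ring
        _ ≤ (n' : ℤ) * (((n : ℤ) * k) * y) := mul_le_mul_of_nonneg_left h2 (by linarith)
        _ = (n : ℤ) * n' * k * y := by ring
  -- upper bound for the right side: `|c (n − n')| ≤ |c| (max(n,n') − 1)`
  have hne : (n : ℤ) ≠ n' := by exact_mod_cast hnn'
  rcases lt_or_gt_of_ne hne with hlt | hlt
  · -- n < n'
    have hR : c * ((n : ℤ) - n') ≤ |c| * ((n' : ℤ) - 1) := by
      have : c * ((n : ℤ) - n') ≤ |c * ((n : ℤ) - n')| := le_abs_self _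
      rw [abs_mul] at this
      have h3 : |(n : ℤ) - n'| = (n' : ℤ) - n := by
        rw [abs_of_neg (by linarith)]; ring
      rw [h3] at this
      nlinarith [abs_nonneg c]
    nlinarith [hprod.2, abs_nonneg c]
  · -- n > n'
    have hR : c * ((n : ℤ) - n') ≤ |c| * ((n : ℤ) - 1) := by
      have : c * ((n : ℤ) - n') ≤ |c * ((n : ℤ) - n')| := le_abs_self _
      rw [abs_mul] at this
      have h3 : |(n : ℤ) - n'| = (n : ℤ) - n' := abs_of_pos (by linarith)
      rw [h3] at this
      nlinarith [abs_nonneg c]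
    nlinarith [hprod.1, abs_nonneg c]


/-- Positivity of the two forms on the fan's boxes: `x > M ≥ |c|`, `y ≥ 0`, `k ≥ 0`. -/
theorem forms_pos {c : ℤ} {n n' : ℕ} {k x y B : ℤ} (hn : 1 ≤ n) (hn' : 1 ≤ n') (hk : 0 ≤ k)
    (hy : 0 ≤ y) (hcB : |c| ≤ B) (hx : B < x) :
    0 < (n : ℤ) * x + (n : ℤ) * k * y + c ∧ 0 < (n' : ℤ) * x + 0 * y + c := by
  have hcneg : -c ≤ |c| := neg_le_abs c
  have hx0 : 0 ≤ x := by linarith [abs_nonneg c]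
  have h1 : (1 : ℤ) * x ≤ (n : ℤ) * x :=
    mul_le_mul_of_nonneg_right (by exact_mod_cast hn) hx0
  have h2 : (1 : ℤ) * x ≤ (n' : ℤ) * x :=
    mul_le_mul_of_nonneg_right (by exact_mod_cast hn') hx0
  have h3 : 0 ≤ (n : ℤ) * k * y := by positivity
  constructor <;> linarith

/-- Non-degeneracy of columns: `nk·(n'x + c) ≠ 0·(…)` because both factors are positive. -/
theorem col_nondegenerate {c : ℤ} {n n' : ℕ} {k x B : ℤ} (hn : 1 ≤ n) (hn' : 1 ≤ n') (hk : 1 ≤ k)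
    (hcB : |c| ≤ B) (hx : B < x) :
    (n : ℤ) * k * ((n' : ℤ) * x + c) ≠ 0 * ((n : ℤ) * x + c) := by
  rw [zero_mul]
  have h := (forms_pos (k := k) (y := 0) hn hn' (by linarith) le_rfl hcB hx).2
  rw [mul_zero, add_zero] at h
  have hn0 : (0 : ℤ) < n := by exact_mod_cast hn
  have : 0 < (n : ℤ) * k * ((n' : ℤ) * x + c) := by positivity
  exact this.ne'

/-! ## §5 The instance of the hypothesis and the block estimate -/

/-- The instance of `SqrtAffineChowla₂'` that is used: exponent `ε`, height exponent `A = 1`, constant `C`. -/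
def HypAt (ε C : ℝ) : Prop :=
  ∀ N X Y : ℕ, 1 ≤ N → X ≤ N → Y ≤ N →
    ∀ x₀ y₀ a₁ b₁ c₁ a₂ b₂ c₂ : ℤ,
      |x₀| ≤ (N : ℝ) ^ (1 : ℝ) → |y₀| ≤ (N : ℝ) ^ (1 : ℝ) →
      |a₁| ≤ (N : ℝ) ^ (1 : ℝ) → |b₁| ≤ (N : ℝ) ^ (1 : ℝ) → |c₁| ≤ (N : ℝ) ^ (1 : ℝ) →
      |a₂| ≤ (N : ℝ) ^ (1 : ℝ) → |b₂| ≤ (N : ℝ) ^ (1 : ℝ) → |c₂| ≤ (N : ℝ) ^ (1 : ℝ) →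
      a₁ * b₂ ≠ a₂ * b₁ →
      (∀ y ∈ Ioc y₀ (y₀ + Y), a₁ * (b₂ * y + c₂) ≠ a₂ * (b₁ * y + c₁)) →
      (∀ x ∈ Ioc x₀ (x₀ + X), b₁ * (a₂ * x + c₂) ≠ b₂ * (a₁ * x + c₁)) →
      (∀ x ∈ Ioc x₀ (x₀ + X), ∀ y ∈ Ioc y₀ (y₀ + Y), 0 < a₁ * x + b₁ * y + c₁ ∧ 0 < a₂ * x + b₂ * y + c₂) →
        |∑ x ∈ Ioc x₀ (x₀ + X), ∑ y ∈ Ioc y₀ (y₀ + Y),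
            (ArithmeticFunction.liouville (Int.toNat (a₁ * x + b₁ * y + c₁)) : ℝ) *
              (ArithmeticFunction.liouville (Int.toNat (a₂ * x + b₂ * y + c₂)) : ℝ)| ≤
          C * Real.sqrt ((X : ℝ) * Y) * (N : ℝ) ^ ε

theorem hypAt_of (h : SqrtAffineChowla₂') {ε : ℝ} (hε : 0 < ε) : ∃ C : ℝ, HypAt ε C := h ε hε 1

/-- The height parameter `N = 8M² + |c| + 8` at which the hypothesis is invoked. -/
def Nb (M : ℕ) (c : ℤ) : ℕ := 8 * M ^ 2 + c.natAbs + 8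

theorem one_le_Nb (M : ℕ) (c : ℤ) : 1 ≤ Nb M c := by unfold Nb; omega

theorem Nb_cast (M : ℕ) (c : ℤ) : ((Nb M c : ℕ) : ℤ) = 8 * (M : ℤ) ^ 2 + |c| + 8 := by
  have h : ((c.natAbs : ℕ) : ℤ) = |c| := Int.natCast_natAbs c
  simp only [Nb, Nat.cast_add, Nat.cast_mul, Nat.cast_pow, Nat.cast_ofNat, h]

theorem cast_abs_le_rpow_one {z : ℤ} {N : ℕ} (h : |z| ≤ (N : ℤ)) :
    ((|z| : ℤ) : ℝ) ≤ (N : ℝ) ^ (1 : ℝ) := by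
  rw [Real.rpow_one]; exact_mod_cast h

/-- BLOCK ESTIMATE: for rows `y ∈ (u, u+Y] ⊆ [Q, 2Q]`, `Y ≤ W ≤ M + 1`, `1 ≤ k < 2Q`, `M ≥ max(1, c²)`:
`|Σ_{y} Σ_{x ∈ (M, 2M−ky]} F| ≤ C⁺√(MW)·N^ε + Y·C⁺√(kW)·N^ε`. -/
theorem block_estimate {ε C : ℝ} (hC : HypAt ε C) {c : ℤ} {M n n' : ℕ} {k : ℤ}
    (hM : 1 ≤ M) (hcM : c.natAbs ^ 2 ≤ M) (hn : 1 ≤ n) (hn' : 1 ≤ n') (hnn' : n ≠ n')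
    (hnM : n ≤ 2 * M) (hn'M : n' ≤ 2 * M) (hk : 1 ≤ k) (hkQ : k ≤ 2 * ((Nat.sqrt M : ℤ) + 1))
    {u : ℤ} {Y W : ℕ} (hu : (Nat.sqrt M : ℤ) ≤ u) (huY : u + Y ≤ 2 * ((Nat.sqrt M : ℤ) + 1))
    (hYW : Y ≤ W) (hW : W ≤ M + 1) :
    |∑ y ∈ Ioc u (u + Y), ∑ x ∈ Ioc (M : ℤ) (2 * M - k * y), F c n n' k x y| ≤
      max C 0 * Real.sqrt ((M : ℝ) * W) * ((Nb M c : ℕ) : ℝ) ^ ε +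
        Y * (max C 0 * Real.sqrt ((k : ℝ) * W) * ((Nb M c : ℕ) : ℝ) ^ ε) := by
  -- integer bookkeeping
  set N : ℕ := Nb M c with hNdef
  have hN1 : 1 ≤ N := one_le_Nb M c
  have hNz : (N : ℤ) = 8 * (M : ℤ) ^ 2 + |c| + 8 := Nb_cast M c
  have hk0 : 0 ≤ k := by linarith
  have hM0 : (0 : ℤ) ≤ M := Nat.cast_nonneg _
  have hsqrtM : (Nat.sqrt M : ℤ) ≤ M := by exact_mod_cast Nat.sqrt_le_self M
  have hsqrt0 : (0 : ℤ) ≤ Nat.sqrt M := Nat.cast_nonneg _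
  have hcabs : (c.natAbs : ℤ) = |c| := Int.natCast_natAbs c
  have hc0 : (0 : ℤ) ≤ |c| := abs_nonneg c
  have hcneg : -c ≤ |c| := neg_le_abs c
  have hcsqrt : c.natAbs ≤ Nat.sqrt M := Nat.le_sqrt'.mpr hcM
  have hcQ : |c| + 1 ≤ (Nat.sqrt M : ℤ) + 1 := by rw [← hcabs]; exact_mod_cast Nat.succ_le_succ hcsqrt
  have hcM' : |c| ≤ (M : ℤ) := by linarith
  have hu0 : 0 ≤ u := le_trans hsqrt0 hu
  have hY0 : (0 : ℤ) ≤ Y := Nat.cast_nonneg _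
  -- the generic `≤ N` facts
  have hMN : (M : ℤ) ≤ N := by rw [hNz]; nlinarith
  have h2MN : 2 * (M : ℤ) ≤ N := by rw [hNz]; nlinarith
  have h2QN : 2 * ((Nat.sqrt M : ℤ) + 1) ≤ N := by rw [hNz]; nlinarith
  have hcN : |c| ≤ (N : ℤ) := by rw [hNz]; nlinarith
  have hnkN : (n : ℤ) * k ≤ N := by
    rw [hNz]
    have h1 : (n : ℤ) * k ≤ (2 * M) * (2 * ((Nat.sqrt M : ℤ) + 1)) :=
      mul_le_mul (by exact_mod_cast hnM) hkQ hk0 (by positivity)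
    nlinarith
  have hnk0 : 0 ≤ (n : ℤ) * k := by positivity
  -- heights (A = 1)
  have hx0 : ((|(M : ℤ)| : ℤ) : ℝ) ≤ (N : ℝ) ^ (1 : ℝ) :=
    cast_abs_le_rpow_one (by rw [abs_of_nonneg hM0]; exact hMN)
  have ha1 : ((|(n : ℤ)| : ℤ) : ℝ) ≤ (N : ℝ) ^ (1 : ℝ) :=
    cast_abs_le_rpow_one (by rw [Nat.abs_cast]; linarith [(show (n : ℤ) ≤ 2 * M by exact_mod_cast hnM)])
  have hb1 : ((|(n : ℤ) * k| : ℤ) : ℝ) ≤ (N : ℝ) ^ (1 : ℝ) :=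
    cast_abs_le_rpow_one (by rw [abs_of_nonneg hnk0]; exact hnkN)
  have hc1 : ((|c| : ℤ) : ℝ) ≤ (N : ℝ) ^ (1 : ℝ) := cast_abs_le_rpow_one hcN
  have ha2 : ((|(n' : ℤ)| : ℤ) : ℝ) ≤ (N : ℝ) ^ (1 : ℝ) :=
    cast_abs_le_rpow_one (by rw [Nat.abs_cast]; linarith [(show (n' : ℤ) ≤ 2 * M by exact_mod_cast hn'M)])
  have hb2 : ((|(0 : ℤ)| : ℤ) : ℝ) ≤ (N : ℝ) ^ (1 : ℝ) :=
    cast_abs_le_rpow_one (by rw [abs_zero]; positivity)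
  have hdet : (n : ℤ) * 0 ≠ (n' : ℤ) * ((n : ℤ) * k) := by
    rw [mul_zero]
    have : 0 < (n' : ℤ) * ((n : ℤ) * k) := by positivity
    exact this.ne
  -- the real constants
  have hCle : C ≤ max C 0 := le_max_left _ _
  have hC0 : 0 ≤ max C 0 := le_max_right _ _
  have hNε : 0 ≤ ((N : ℕ) : ℝ) ^ ε := Real.rpow_nonneg (Nat.cast_nonneg _) _
  set bs : ℤ := bEnd M k (u + Y) with hbs
  have hbsM : (M : ℤ) ≤ bs := le_bEnd M k _
  have hbs2M : bs ≤ 2 * M := bEnd_le M hk0 (by linarith)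
  refine block_bound (F c n n' k) M hk0 u Y ?_ ?_
  · -- the common box `(M, bs] × (u, u+Y]`
    set X : ℕ := Int.toNat (bs - M) with hXdef
    have hXz : (X : ℤ) = bs - M := Int.toNat_of_nonneg (by linarith)
    have hbsX : bs = (M : ℤ) + X := by linarith
    have hXM : X ≤ M := by
      have : (X : ℤ) ≤ M := by linarith
      exact_mod_cast this
    have hXN : X ≤ N := by
      have : (X : ℤ) ≤ N := by linarith
      exact_mod_cast this
    have hYN : Y ≤ N := by
      have : (Y : ℤ) ≤ N := by
        have : (W : ℤ) ≤ M + 1 := by exact_mod_cast hW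
        have : (Y : ℤ) ≤ W := by exact_mod_cast hYW
        linarith
      exact_mod_cast this
    have hy0 : ((|u| : ℤ) : ℝ) ≤ (N : ℝ) ^ (1 : ℝ) :=
      cast_abs_le_rpow_one (by rw [abs_of_nonneg hu0]; linarith)
    have hrow : ∀ y ∈ Ioc u (u + Y), (n : ℤ) * (0 * y + c) ≠ (n' : ℤ) * ((n : ℤ) * k * y + c) := by
      intro y hy
      rw [mem_Ioc] at hy
      exact row_nondegenerate hn hn' hnn' hk (by rw [hcabs]; linarith)
    have hcol : ∀ x ∈ Ioc (M : ℤ) ((M : ℤ) + X),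
        (n : ℤ) * k * ((n' : ℤ) * x + c) ≠ 0 * ((n : ℤ) * x + c) := by
      intro x hx
      rw [mem_Ioc] at hx
      exact col_nondegenerate hn hn' hk hcM' hx.1
    have hpos : ∀ x ∈ Ioc (M : ℤ) ((M : ℤ) + X), ∀ y ∈ Ioc u (u + Y),
        0 < (n : ℤ) * x + (n : ℤ) * k * y + c ∧ 0 < (n' : ℤ) * x + 0 * y + c := by
      intro x hx y hy
      rw [mem_Ioc] at hx hy
      exact forms_pos hn hn' hk0 (by linarith only [hu0, hy.1]) hcM' hx.1
    have hbox := hC N X Y hN1 hXN hYN (M : ℤ) u (n : ℤ) ((n : ℤ) * k) c (n' : ℤ) 0 c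
      hx0 hy0 ha1 hb1 hc1 ha2 hb2 hc1 hdet hrow hcol hpos
    rw [← hbs, hbsX]
    simp only [F]
    refine le_trans hbox ?_
    have hsq : Real.sqrt ((X : ℝ) * Y) ≤ Real.sqrt ((M : ℝ) * W) := by
      apply Real.sqrt_le_sqrt
      have h1 : (X : ℝ) ≤ M := by exact_mod_cast hXM
      have h2 : (Y : ℝ) ≤ W := by exact_mod_cast hYW
      exact mul_le_mul h1 h2 (Nat.cast_nonneg _) (Nat.cast_nonneg _)
    have hs0 : 0 ≤ Real.sqrt ((X : ℝ) * Y) := Real.sqrt_nonneg _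
    calc C * Real.sqrt ((X : ℝ) * Y) * (N : ℝ) ^ ε
        ≤ max C 0 * Real.sqrt ((X : ℝ) * Y) * (N : ℝ) ^ ε := by
          apply mul_le_mul_of_nonneg_right _ hNε
          exact mul_le_mul_of_nonneg_right hCle hs0
      _ ≤ max C 0 * Real.sqrt ((M : ℝ) * W) * (N : ℝ) ^ ε := by
          apply mul_le_mul_of_nonneg_right _ hNε
          exact mul_le_mul_of_nonneg_left hsq hC0
  · -- the leftover row segments `(bs, b y] × {y}`
    intro y hy
    rw [mem_Ioc] at hy
    have hyu : u + 1 ≤ y := hy.1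
    set X' : ℕ := Int.toNat (bEnd M k y - bs) with hX'def
    have hX'z : (X' : ℤ) = bEnd M k y - bs :=
      Int.toNat_of_nonneg (by have := bEnd_antitone M hk0 hy.2; linarith)
    have hbyX : bEnd M k y = bs + X' := by linarith
    have hby2M : bEnd M k y ≤ 2 * M := bEnd_le M hk0 (by linarith)
    have hX'kW : (X' : ℤ) ≤ k * W := by
      have h1 := bEnd_sub_le M hk0 hy.2
      have h2 : k * (u + Y - y) ≤ k * W := by
        apply mul_le_mul_of_nonneg_left _ hk0
        have : (Y : ℤ) ≤ W := by exact_mod_cast hYW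
        linarith
      linarith
    have hX'N : X' ≤ N := by
      have : (X' : ℤ) ≤ N := by linarith
      exact_mod_cast this
    have h1N : 1 ≤ N := hN1
    have hx0' : ((|bs| : ℤ) : ℝ) ≤ (N : ℝ) ^ (1 : ℝ) :=
      cast_abs_le_rpow_one (by rw [abs_of_nonneg (by linarith)]; linarith)
    have hy0' : ((|y - 1| : ℤ) : ℝ) ≤ (N : ℝ) ^ (1 : ℝ) :=
      cast_abs_le_rpow_one (by rw [abs_of_nonneg (by linarith)]; linarith)
    have hrow : ∀ y' ∈ Ioc (y - 1) (y - 1 + ((1 : ℕ) : ℤ)),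
        (n : ℤ) * (0 * y' + c) ≠ (n' : ℤ) * ((n : ℤ) * k * y' + c) := by
      intro y' hy'
      rw [Ioc_pred_eq_singleton, mem_singleton] at hy'
      rw [hy']
      exact row_nondegenerate hn hn' hnn' hk (by rw [hcabs]; linarith)
    have hcbs : |c| ≤ bs := le_trans hcM' hbsM
    have hcol : ∀ x ∈ Ioc bs (bs + X'),
        (n : ℤ) * k * ((n' : ℤ) * x + c) ≠ 0 * ((n : ℤ) * x + c) := by
      intro x hx
      rw [mem_Ioc] at hx
      exact col_nondegenerate hn hn' hk hcbs hx.1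
    have hpos : ∀ x ∈ Ioc bs (bs + X'), ∀ y' ∈ Ioc (y - 1) (y - 1 + ((1 : ℕ) : ℤ)),
        0 < (n : ℤ) * x + (n : ℤ) * k * y' + c ∧ 0 < (n' : ℤ) * x + 0 * y' + c := by
      intro x hx y' hy'
      rw [mem_Ioc] at hx
      rw [Ioc_pred_eq_singleton, mem_singleton] at hy'
      rw [hy']
      exact forms_pos hn hn' hk0 (by linarith only [hu0, hyu]) hcbs hx.1
    have hbox := hC N X' 1 hN1 hX'N hN1 bs (y - 1) (n : ℤ) ((n : ℤ) * k) c (n' : ℤ) 0 c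
      hx0' hy0' ha1 hb1 hc1 ha2 hb2 hc1 hdet hrow hcol hpos
    rw [hbyX]
    have hsingle : ∀ x : ℤ, ∑ y' ∈ Ioc (y - 1) (y - 1 + ((1 : ℕ) : ℤ)), F c n n' k x y' = F c n n' k x y := by
      intro x
      rw [Ioc_pred_eq_singleton, sum_singleton]
    have hbox' : |∑ x ∈ Ioc bs (bs + X'), F c n n' k x y| ≤ C * Real.sqrt ((X' : ℝ) * (1 : ℕ)) * (N : ℝ) ^ ε := by
      have := hbox
      simp only [F] at hsingle ⊢
      rw [← sum_congr rfl (fun x _ => hsingle x)]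
      exact this
    refine le_trans hbox' ?_
    have hsq : Real.sqrt ((X' : ℝ) * (1 : ℕ)) ≤ Real.sqrt ((k : ℝ) * W) := by
      apply Real.sqrt_le_sqrt
      rw [Nat.cast_one, mul_one]
      exact_mod_cast hX'kW
    have hs0 : 0 ≤ Real.sqrt ((X' : ℝ) * (1 : ℕ)) := Real.sqrt_nonneg _
    calc C * Real.sqrt ((X' : ℝ) * (1 : ℕ)) * (N : ℝ) ^ ε
        ≤ max C 0 * Real.sqrt ((X' : ℝ) * (1 : ℕ)) * (N : ℝ) ^ ε := by
          apply mul_le_mul_of_nonneg_right _ hNε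
          exact mul_le_mul_of_nonneg_right hCle hs0
      _ ≤ max C 0 * Real.sqrt ((k : ℝ) * W) * (N : ℝ) ^ ε := by
          apply mul_le_mul_of_nonneg_right _ hNε
          exact mul_le_mul_of_nonneg_left hsq hC0


/-! ## §6 The whole fan for `k ≥ 1`: rows re-indexed over `ℤ`, chopped into blocks -/

/-- The fan `R_k` (`k ≥ 0`) as a sum over integer rows `y ∈ (⌊√M⌋, ⌊√M⌋ + Q]`, `Q = ⌊√M⌋ + 1`. -/
theorem fan_eq_rows (c : ℤ) (n n' M : ℕ) {k : ℤ} (hk : 0 ≤ k) :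
    (∑ j ∈ Ico (Nat.sqrt M + 1) (2 * (Nat.sqrt M + 1)),
        ∑ p ∈ (Ioc M (2 * M) ×ˢ Ioc M (2 * M)).filter (fun p : ℕ × ℕ => (p.1 : ℤ) - p.2 = k * (j : ℤ)),
          (liouville (Int.toNat ((p.1 : ℤ) * n + c)) : ℝ) * (liouville (Int.toNat ((p.2 : ℤ) * n' + c)) : ℝ)) =
      ∑ y ∈ Ioc (Nat.sqrt M : ℤ) ((Nat.sqrt M : ℤ) + ((Nat.sqrt M + 1 : ℕ) : ℤ)),
        ∑ x ∈ Ioc (M : ℤ) (2 * M - k * y), F c n n' k x y := by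
  rw [sum_congr rfl (fun j _ => lag_sum_eq c n n' M j hk)]
  refine Finset.sum_nbij' (fun j : ℕ => (j : ℤ)) (fun y : ℤ => Int.toNat y) ?_ ?_ ?_ ?_ ?_
  · intro j hj
    rw [mem_Ico] at hj
    rw [mem_Ioc]
    push_cast
    constructor
    · exact_mod_cast hj.1
    · have : j + 1 ≤ 2 * (Nat.sqrt M + 1) := hj.2
      have : ((j + 1 : ℕ) : ℤ) ≤ ((2 * (Nat.sqrt M + 1) : ℕ) : ℤ) := by exact_mod_cast this
      push_cast at this
      linarith
  · intro y hy
    rw [mem_Ioc] at hy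
    push_cast at hy
    rw [mem_Ico]
    have hy0 : 0 ≤ y := by linarith [(Nat.cast_nonneg (Nat.sqrt M) : (0 : ℤ) ≤ Nat.sqrt M)]
    constructor
    · have : ((Nat.sqrt M + 1 : ℕ) : ℤ) ≤ y := by push_cast; linarith
      have := Int.toNat_le_toNat this
      simpa using this
    · have h2 : y < ((2 * (Nat.sqrt M + 1) : ℕ) : ℤ) := by push_cast; linarith
      exact (Int.toNat_lt hy0).mpr h2
  · intro j _
    simp
  · intro y hy
    rw [mem_Ioc] at hy
    have hy0 : 0 ≤ y := by linarith [(Nat.cast_nonneg (Nat.sqrt M) : (0 : ℤ) ≤ Nat.sqrt M)]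
    simp [Int.toNat_of_nonneg hy0]
  · intro j _
    rfl

/-- The fan for `1 ≤ k ≤ 2Q` at `M ≥ max(1, c²)`, chopped into blocks of `W` rows (`1 ≤ W ≤ M + 1`):
`|R_k| ≤ (Q/W + 1)·(C⁺√(MW) + W·C⁺√(kW))·N^ε`. -/
theorem fan_abs_le_blocks {ε C : ℝ} (hC : HypAt ε C) {c : ℤ} {M n n' : ℕ} {k : ℤ}
    (hM : 1 ≤ M) (hcM : c.natAbs ^ 2 ≤ M) (hn : 1 ≤ n) (hn' : 1 ≤ n') (hnn' : n ≠ n')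
    (hnM : n ≤ 2 * M) (hn'M : n' ≤ 2 * M) (hk : 1 ≤ k) (hkQ : k ≤ 2 * ((Nat.sqrt M : ℤ) + 1))
    {W : ℕ} (hW1 : 1 ≤ W) (hW : W ≤ M + 1) :
    |∑ j ∈ Ico (Nat.sqrt M + 1) (2 * (Nat.sqrt M + 1)),
        ∑ p ∈ (Ioc M (2 * M) ×ˢ Ioc M (2 * M)).filter (fun p : ℕ × ℕ => (p.1 : ℤ) - p.2 = k * (j : ℤ)),
          (liouville (Int.toNat ((p.1 : ℤ) * n + c)) : ℝ) * (liouville (Int.toNat ((p.2 : ℤ) * n' + c)) : ℝ)| ≤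
      (((Nat.sqrt M + 1) / W + 1 : ℕ) : ℝ) *
        (max C 0 * Real.sqrt ((M : ℝ) * W) * ((Nb M c : ℕ) : ℝ) ^ ε +
          W * (max C 0 * Real.sqrt ((k : ℝ) * W) * ((Nb M c : ℕ) : ℝ) ^ ε)) := by
  rw [fan_eq_rows c n n' M (by linarith : (0 : ℤ) ≤ k)]
  refine abs_sum_Ioc_le_of_blocks (fun y => ∑ x ∈ Ioc (M : ℤ) (2 * M - k * y), F c n n' k x y) hW1 _
    (Nat.sqrt M + 1) (Nat.sqrt M : ℤ) ?_
  intro u Y hu huY hYW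
  have huY' : u + Y ≤ 2 * ((Nat.sqrt M : ℤ) + 1) := by push_cast at huY; linarith
  refine le_trans (block_estimate hC hM hcM hn hn' hnn' hnM hn'M hk hkQ hu huY' hYW hW) ?_
  have h0 : 0 ≤ max C 0 * Real.sqrt ((k : ℝ) * W) * ((Nb M c : ℕ) : ℝ) ^ ε := by
    have : 0 ≤ max C 0 := le_max_right _ _
    have : 0 ≤ ((Nb M c : ℕ) : ℝ) ^ ε := Real.rpow_nonneg (Nat.cast_nonneg _) _
    positivity
  have hYW' : (Y : ℝ) ≤ W := by exact_mod_cast hYW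
  nlinarith


/-! ## §7 Exponent bookkeeping: blocks of `W = ⌈M^{1/4}⌉` rows give `M^{7/8 + 2ε}` -/

/-- The block width `W = ⌈M^{1/4}⌉₊` and its elementary bounds. -/
theorem W_bounds {M : ℕ} (hM : 1 ≤ M) :
    ((M : ℝ) ^ (1 / 4 : ℝ) ≤ (⌈(M : ℝ) ^ (1 / 4 : ℝ)⌉₊ : ℝ)) ∧
      ((⌈(M : ℝ) ^ (1 / 4 : ℝ)⌉₊ : ℝ) ≤ 2 * (M : ℝ) ^ (1 / 4 : ℝ)) ∧
        1 ≤ ⌈(M : ℝ) ^ (1 / 4 : ℝ)⌉₊ ∧ ⌈(M : ℝ) ^ (1 / 4 : ℝ)⌉₊ ≤ M + 1 := by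
  have hMr : (1 : ℝ) ≤ M := by exact_mod_cast hM
  have h0 : (0 : ℝ) ≤ (M : ℝ) ^ (1 / 4 : ℝ) := Real.rpow_nonneg (by linarith) _
  have h1 : (1 : ℝ) ≤ (M : ℝ) ^ (1 / 4 : ℝ) := Real.one_le_rpow hMr (by norm_num)
  have hle : (M : ℝ) ^ (1 / 4 : ℝ) ≤ (⌈(M : ℝ) ^ (1 / 4 : ℝ)⌉₊ : ℝ) := Nat.le_ceil _
  have hlt : (⌈(M : ℝ) ^ (1 / 4 : ℝ)⌉₊ : ℝ) < (M : ℝ) ^ (1 / 4 : ℝ) + 1 := Nat.ceil_lt_add_one h0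
  have hM1 : (M : ℝ) ^ (1 / 4 : ℝ) ≤ M := by
    calc (M : ℝ) ^ (1 / 4 : ℝ) ≤ (M : ℝ) ^ (1 : ℝ) :=
          Real.rpow_le_rpow_of_exponent_le hMr (by norm_num)
      _ = M := Real.rpow_one _
  refine ⟨hle, by linarith, ?_, ?_⟩
  · have : (1 : ℝ) ≤ (⌈(M : ℝ) ^ (1 / 4 : ℝ)⌉₊ : ℝ) := le_trans h1 hle
    exact_mod_cast this
  · have : (⌈(M : ℝ) ^ (1 / 4 : ℝ)⌉₊ : ℝ) ≤ ((M + 1 : ℕ) : ℝ) := by push_cast; linarith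
    exact_mod_cast this

/-- `(M^a)^2 = M^(2a)` for `M ≥ 0`. -/
theorem rpow_sq {M : ℝ} (hM : 0 ≤ M) (a : ℝ) : ((M ^ a) ^ 2 : ℝ) = M ^ (2 * a) := by
  rw [← Real.rpow_natCast, ← Real.rpow_mul hM]; norm_num; ring_nf

/-- NUMERIC ASSEMBLY: with `D ≤ Q/W + 1`, `Q ≤ 2√M`, `M^{1/4} ≤ W ≤ 2M^{1/4}`, `k ≤ 2Q`,
`N ≤ (cc + 16)·M²`, `0 < ε ≤ 1`:
`D·(C⁺√(MW)·N^ε + W·C⁺√(kW)·N^ε) ≤ 24·C⁺·(cc+16)·M^{7/8+2ε}`. -/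
theorem numeric_bound {M Q W k Cp N cc ε D : ℝ} (hM : 1 ≤ M) (hCp : 0 ≤ Cp) (hε0 : 0 < ε) (hε1 : ε ≤ 1)
    (hQ : Q ≤ 2 * M ^ (1 / 2 : ℝ)) (hWlo : M ^ (1 / 4 : ℝ) ≤ W) (hWhi : W ≤ 2 * M ^ (1 / 4 : ℝ))
    (hk : k ≤ 2 * Q) (hcc : 0 ≤ cc) (hN0 : 0 ≤ N) (hN : N ≤ (cc + 16) * M ^ 2)
    (hD : D ≤ Q / W + 1) :
    D * (Cp * Real.sqrt (M * W) * N ^ ε + W * (Cp * Real.sqrt (k * W) * N ^ ε)) ≤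
      24 * Cp * (cc + 16) * M ^ (7 / 8 + 2 * ε) := by
  have hM0 : 0 < M := by linarith
  have hM0' : 0 ≤ M := hM0.le
  have h14 : (1 : ℝ) ≤ M ^ (1 / 4 : ℝ) := Real.one_le_rpow hM (by norm_num)
  have hW0 : 0 < W := by linarith
  have hrp : ∀ a : ℝ, 0 ≤ M ^ a := fun a => Real.rpow_nonneg hM0' a
  -- (1) D ≤ 3 M^{1/4}
  have hD3 : D ≤ 3 * M ^ (1 / 4 : ℝ) := by
    have h1 : Q / W ≤ (2 * M ^ (1 / 2 : ℝ)) / M ^ (1 / 4 : ℝ) :=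
      div_le_div₀ (by positivity) hQ (by positivity) hWlo
    have h2 : (2 * M ^ (1 / 2 : ℝ)) / M ^ (1 / 4 : ℝ) = 2 * M ^ (1 / 4 : ℝ) := by
      rw [mul_div_assoc, ← Real.rpow_sub hM0]; norm_num
    linarith
  -- (2) √(MW) ≤ 2 M^{5/8}
  have hS1 : Real.sqrt (M * W) ≤ 2 * M ^ (5 / 8 : ℝ) := by
    have hsq : M * W ≤ (2 * M ^ (5 / 8 : ℝ)) ^ 2 := by
      have h1 : M * W ≤ M * (2 * M ^ (1 / 4 : ℝ)) := mul_le_mul_of_nonneg_left hWhi hM0'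
      have h2 : M * (2 * M ^ (1 / 4 : ℝ)) = 2 * M ^ (5 / 4 : ℝ) := by
        have : M ^ (5 / 4 : ℝ) = M ^ (1 : ℝ) * M ^ (1 / 4 : ℝ) := by
          rw [← Real.rpow_add hM0]; norm_num
        rw [this, Real.rpow_one]; ring
      have h3 : (2 * M ^ (5 / 8 : ℝ)) ^ 2 = 4 * M ^ (5 / 4 : ℝ) := by
        rw [mul_pow, rpow_sq hM0']; norm_num
      rw [h3]; linarith [hrp (5 / 4 : ℝ)]
    calc Real.sqrt (M * W) ≤ Real.sqrt ((2 * M ^ (5 / 8 : ℝ)) ^ 2) := Real.sqrt_le_sqrt hsq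
      _ = 2 * M ^ (5 / 8 : ℝ) := Real.sqrt_sq (by positivity)
  -- (3) W √(kW) ≤ 6 M^{5/8}
  have hS2 : W * Real.sqrt (k * W) ≤ 6 * M ^ (5 / 8 : ℝ) := by
    have hsq : k * W ≤ (3 * M ^ (3 / 8 : ℝ)) ^ 2 := by
      have h1 : k * W ≤ (2 * (2 * M ^ (1 / 2 : ℝ))) * (2 * M ^ (1 / 4 : ℝ)) :=
        mul_le_mul (by linarith) hWhi hW0.le (by positivity)
      have h2 : (2 * (2 * M ^ (1 / 2 : ℝ))) * (2 * M ^ (1 / 4 : ℝ)) = 8 * M ^ (3 / 4 : ℝ) := by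
        have : M ^ (3 / 4 : ℝ) = M ^ (1 / 2 : ℝ) * M ^ (1 / 4 : ℝ) := by
          rw [← Real.rpow_add hM0]; norm_num
        rw [this]; ring
      have h3 : (3 * M ^ (3 / 8 : ℝ)) ^ 2 = 9 * M ^ (3 / 4 : ℝ) := by
        rw [mul_pow, rpow_sq hM0']; norm_num
      rw [h3]; linarith [hrp (3 / 4 : ℝ)]
    have hs : Real.sqrt (k * W) ≤ 3 * M ^ (3 / 8 : ℝ) :=
      calc Real.sqrt (k * W) ≤ Real.sqrt ((3 * M ^ (3 / 8 : ℝ)) ^ 2) := Real.sqrt_le_sqrt hsq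
        _ = 3 * M ^ (3 / 8 : ℝ) := Real.sqrt_sq (by positivity)
    have h58 : M ^ (1 / 4 : ℝ) * M ^ (3 / 8 : ℝ) = M ^ (5 / 8 : ℝ) := by
      rw [← Real.rpow_add hM0]; norm_num
    calc W * Real.sqrt (k * W) ≤ (2 * M ^ (1 / 4 : ℝ)) * (3 * M ^ (3 / 8 : ℝ)) :=
          mul_le_mul hWhi hs (Real.sqrt_nonneg _) (by positivity)
      _ = 6 * M ^ (5 / 8 : ℝ) := by rw [← h58]; ring
  -- (4) N^ε ≤ (cc+16) M^{2ε}
  have hNε : N ^ ε ≤ (cc + 16) * M ^ (2 * ε) := by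
    have h1 : N ^ ε ≤ ((cc + 16) * M ^ 2) ^ ε := Real.rpow_le_rpow hN0 hN hε0.le
    have h2 : ((cc + 16) * M ^ 2) ^ ε = (cc + 16) ^ ε * (M ^ 2) ^ ε :=
      Real.mul_rpow (by linarith) (by positivity)
    have h3 : (cc + 16) ^ ε ≤ cc + 16 := by
      calc (cc + 16) ^ ε ≤ (cc + 16) ^ (1 : ℝ) :=
            Real.rpow_le_rpow_of_exponent_le (by linarith) hε1
        _ = cc + 16 := Real.rpow_one _
    have h4 : ((M ^ 2) ^ ε : ℝ) = M ^ (2 * ε) := by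
      rw [show (M ^ 2 : ℝ) = M ^ (2 : ℝ) by rw [← Real.rpow_natCast]; norm_num, ← Real.rpow_mul hM0']
    rw [h2, h4] at h1
    exact le_trans h1 (mul_le_mul_of_nonneg_right h3 (hrp _))
  -- (5) combine
  have hNε0 : 0 ≤ N ^ ε := Real.rpow_nonneg hN0 _
  have hE : Real.sqrt (M * W) + W * Real.sqrt (k * W) ≤ 8 * M ^ (5 / 8 : ℝ) := by linarith
  have hE0 : 0 ≤ Real.sqrt (M * W) + W * Real.sqrt (k * W) := by positivity
  calc D * (Cp * Real.sqrt (M * W) * N ^ ε + W * (Cp * Real.sqrt (k * W) * N ^ ε))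
      = D * N ^ ε * Cp * (Real.sqrt (M * W) + W * Real.sqrt (k * W)) := by ring
    _ ≤ (3 * M ^ (1 / 4 : ℝ)) * ((cc + 16) * M ^ (2 * ε)) * Cp * (8 * M ^ (5 / 8 : ℝ)) := by
        gcongr
    _ = 24 * Cp * (cc + 16) * (M ^ (1 / 4 : ℝ) * M ^ (2 * ε) * M ^ (5 / 8 : ℝ)) := by ring
    _ = 24 * Cp * (cc + 16) * M ^ (7 / 8 + 2 * ε) := by
        rw [← Real.rpow_add hM0, ← Real.rpow_add hM0]
        congr 1
        congr 1
        ring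


/-! ## §8 The implication -/

/-- MAIN CASE `k ≥ 1`, `M ≥ max(1, c²)`: `|R_k| ≤ 24·C⁺·(|c|+16)·M^{3/4 + 5/32}` (blocks of `⌈M^{1/4}⌉` rows,
`ε = 1/64`; the fan is empty for `k ≥ 2Q`). -/
theorem fan_pos_k {C : ℝ} (hC : HypAt (1 / 64) C) {c : ℤ} {M n n' : ℕ} {k : ℤ}
    (hM : 1 ≤ M) (hcM : c.natAbs ^ 2 ≤ M) (hn : 1 ≤ n) (hn' : 1 ≤ n') (hnn' : n ≠ n')
    (hnM : n ≤ 2 * M) (hn'M : n' ≤ 2 * M) (hk : 1 ≤ k) :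
    |∑ j ∈ Ico (Nat.sqrt M + 1) (2 * (Nat.sqrt M + 1)),
        ∑ p ∈ (Ioc M (2 * M) ×ˢ Ioc M (2 * M)).filter (fun p : ℕ × ℕ => (p.1 : ℤ) - p.2 = k * (j : ℤ)),
          (liouville (Int.toNat ((p.1 : ℤ) * n + c)) : ℝ) * (liouville (Int.toNat ((p.2 : ℤ) * n' + c)) : ℝ)| ≤
      24 * max C 0 * ((c.natAbs : ℝ) + 16) * (M : ℝ) ^ (3 / 4 + 5 / 32 : ℝ) := by
  have hMr : (1 : ℝ) ≤ M := by exact_mod_cast hM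
  have hM0 : (0 : ℝ) < M := by linarith
  rcases le_or_gt (2 * ((Nat.sqrt M : ℤ) + 1)) k with hbig | hsmall
  · -- empty fan
    rw [fanSum_eq_zero_of_le c n n' M k (by exact_mod_cast hbig), abs_zero]
    have : 0 ≤ max C 0 := le_max_right _ _
    positivity
  · obtain ⟨hWlo, hWhi, hW1, hWM⟩ := W_bounds hM
    refine le_trans (fan_abs_le_blocks hC hM hcM hn hn' hnn' hnM hn'M hk hsmall.le hW1 hWM) ?_
    -- the hypotheses of `numeric_bound`
    have hQ : ((Nat.sqrt M + 1 : ℕ) : ℝ) ≤ 2 * (M : ℝ) ^ (1 / 2 : ℝ) := by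
      have h1 : ((Nat.sqrt M : ℕ) : ℝ) ≤ Real.sqrt M := by
        have hsq : ((Nat.sqrt M : ℕ) : ℝ) ^ 2 ≤ M := by exact_mod_cast Nat.sqrt_le' M
        calc ((Nat.sqrt M : ℕ) : ℝ) = Real.sqrt (((Nat.sqrt M : ℕ) : ℝ) ^ 2) :=
              (Real.sqrt_sq (Nat.cast_nonneg _)).symm
          _ ≤ Real.sqrt M := Real.sqrt_le_sqrt hsq
      have h2 : Real.sqrt M = (M : ℝ) ^ (1 / 2 : ℝ) := Real.sqrt_eq_rpow _
      have h3 : (1 : ℝ) ≤ (M : ℝ) ^ (1 / 2 : ℝ) := Real.one_le_rpow hMr (by norm_num)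
      push_cast
      linarith
    have hkr : (k : ℝ) ≤ 2 * ((Nat.sqrt M + 1 : ℕ) : ℝ) := by
      have h1 : k ≤ 2 * ((Nat.sqrt M : ℤ) + 1) := hsmall.le
      have h2 : (k : ℝ) ≤ ((2 * ((Nat.sqrt M : ℤ) + 1) : ℤ) : ℝ) := by exact_mod_cast h1
      push_cast at h2 ⊢
      linarith
    have hN : ((Nb M c : ℕ) : ℝ) ≤ ((c.natAbs : ℝ) + 16) * (M : ℝ) ^ 2 := by
      unfold Nb
      push_cast
      have hA : (0 : ℝ) ≤ (c.natAbs : ℝ) := Nat.cast_nonneg _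
      have hM2 : (1 : ℝ) ≤ (M : ℝ) ^ 2 := one_le_pow₀ hMr
      nlinarith [mul_nonneg hA (sub_nonneg.mpr hM2)]
    have hD : ((((Nat.sqrt M + 1) / ⌈(M : ℝ) ^ (1 / 4 : ℝ)⌉₊ + 1 : ℕ)) : ℝ) ≤
        ((Nat.sqrt M + 1 : ℕ) : ℝ) / (⌈(M : ℝ) ^ (1 / 4 : ℝ)⌉₊ : ℝ) + 1 := by
      push_cast
      have hdiv : ((((Nat.sqrt M + 1) / ⌈(M : ℝ) ^ (1 / 4 : ℝ)⌉₊ : ℕ)) : ℝ) ≤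
          ((Nat.sqrt M + 1 : ℕ) : ℝ) / (⌈(M : ℝ) ^ (1 / 4 : ℝ)⌉₊ : ℝ) :=
        Nat.cast_div_le (m := Nat.sqrt M + 1) (n := ⌈(M : ℝ) ^ (1 / 4 : ℝ)⌉₊)
      push_cast at hdiv ⊢
      linarith
    have key := numeric_bound (Cp := max C 0) (ε := 1 / 64) hMr (le_max_right _ _) (by norm_num) (by norm_num)
      hQ hWlo hWhi hkr (Nat.cast_nonneg _) (Nat.cast_nonneg _) hN hD
    have he : (7 / 8 + 2 * (1 / 64) : ℝ) = 3 / 4 + 5 / 32 := by norm_num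
    rw [he] at key
    exact key

/-- **The repaired parent conjecture implies the crux.**  `SqrtAffineChowla₂' → FanDecorrelation`, with
`ϑ = 5/32` (`ε = 1/64`) and `C = 24·C⁺·(|c|+16) + (|c|+1)⁶`. -/
theorem fanDecorrelation_of_sqrtAffineChowla₂' (h : SqrtAffineChowla₂') : FanDecorrelation := by
  intro c hc
  obtain ⟨C, hC⟩ := hypAt_of h (by norm_num : (0 : ℝ) < 1 / 64)
  refine ⟨5 / 32, by norm_num, 24 * max C 0 * ((c.natAbs : ℝ) + 16) + ((c.natAbs : ℝ) + 1) ^ 6, ?_⟩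
  intro M n n' k hn hn' hnn' hnM hn'M hk
  have hM : 1 ≤ M := by omega
  have hMr : (1 : ℝ) ≤ M := by exact_mod_cast hM
  have hC0 : 0 ≤ max C 0 := le_max_right _ _
  have hK1 : 0 ≤ 24 * max C 0 * ((c.natAbs : ℝ) + 16) := by positivity
  have hK2 : 0 ≤ ((c.natAbs : ℝ) + 1) ^ 6 := by positivity
  have hMe : 1 ≤ (M : ℝ) ^ (3 / 4 + 5 / 32 : ℝ) := Real.one_le_rpow hMr (by norm_num)
  have hMe0 : 0 ≤ (M : ℝ) ^ (3 / 4 + 5 / 32 : ℝ) := by linarith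
  by_cases hcM : c.natAbs ^ 2 ≤ M
  · -- main case `M ≥ c²`: positive `k` directly, negative `k` by the swap `(m,m') ↦ (m',m)`
    have hfin : 24 * max C 0 * ((c.natAbs : ℝ) + 16) * (M : ℝ) ^ (3 / 4 + 5 / 32 : ℝ) ≤
        (24 * max C 0 * ((c.natAbs : ℝ) + 16) + ((c.natAbs : ℝ) + 1) ^ 6) *
          (M : ℝ) ^ (3 / 4 + 5 / 32 : ℝ) := by nlinarith
    rcases lt_or_gt_of_ne hk with hneg | hpos
    · obtain ⟨k', rfl⟩ : ∃ k' : ℤ, k = -k' := ⟨-k, by ring⟩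
      rw [fanSum_neg c n n' M k']
      exact le_trans (fan_pos_k hC hM hcM hn' hn hnn'.symm hn'M hnM (by linarith)) hfin
    · exact le_trans (fan_pos_k hC hM hcM hn hn' hnn' hnM hn'M (by linarith)) hfin
  · -- small `M < c²`: the trivial bound is a constant
    rw [not_le] at hcM
    refine le_trans (abs_fanSum_le c n n' M k) ?_
    have hs : Nat.sqrt M + 1 ≤ c.natAbs ^ 2 + 1 := by
      have := Nat.sqrt_le_self M; omega
    have hs' : ((Nat.sqrt M + 1 : ℕ) : ℝ) ≤ (c.natAbs : ℝ) ^ 2 + 1 := by exact_mod_cast hs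
    have hM2 : (M : ℝ) ≤ (c.natAbs : ℝ) ^ 2 := by exact_mod_cast hcM.le
    have e1 : ((Nat.sqrt M + 1 : ℕ) : ℝ) * (M : ℝ) ^ 2 ≤ ((c.natAbs : ℝ) ^ 2 + 1) * ((c.natAbs : ℝ) ^ 2) ^ 2 :=
      mul_le_mul hs' (pow_le_pow_left₀ (Nat.cast_nonneg _) hM2 2) (by positivity) (by positivity)
    have e2 : ((c.natAbs : ℝ) ^ 2 + 1) * ((c.natAbs : ℝ) ^ 2) ^ 2 ≤ ((c.natAbs : ℝ) + 1) ^ 6 := by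
      have : 0 ≤ ((c.natAbs : ℝ) + 1) ^ 6 - ((c.natAbs : ℝ) ^ 2 + 1) * ((c.natAbs : ℝ) ^ 2) ^ 2 := by
        ring_nf
        positivity
      linarith
    calc ((Nat.sqrt M + 1 : ℕ) : ℝ) * (M : ℝ) ^ 2 ≤ ((c.natAbs : ℝ) + 1) ^ 6 := le_trans e1 e2
      _ = ((c.natAbs : ℝ) + 1) ^ 6 * 1 := (mul_one _).symm
      _ ≤ ((c.natAbs : ℝ) + 1) ^ 6 * (M : ℝ) ^ (3 / 4 + 5 / 32 : ℝ) :=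
          mul_le_mul_of_nonneg_left hMe hK2
      _ ≤ (24 * max C 0 * ((c.natAbs : ℝ) + 16) + ((c.natAbs : ℝ) + 1) ^ 6) *
            (M : ℝ) ^ (3 / 4 + 5 / 32 : ℝ) := by nlinarith

end

end Summit.Parity.GeneralizedHardyLittlewood.Cruxes.FanDecorrelation.SqrtAffineChowlaTwoRepaired
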